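import Summits.AtomisticToContinuum.HydrodynamicLimit.Theorems.CollisionIsometryCLTCollisionalTransferLocalityValueChiConeConst
import Summits.AtomisticToContinuum.HydrodynamicLimit.Theorems.CollisionIsometryCLTCollisionalTransferLocalityValueChiMesoConst
import Summits.AtomisticToContinuum.HydrodynamicLimit.Theorems.CollisionIsometryCLTCollisionalTransferLocalityEquilibriumRungAssembly
import Summits.AtomisticToContinuum.HydrodynamicLimit.Theorems.CollisionIsometryCLTCollisionalTransferLocalityFmrRung0
import HarnessLib

/-!
# The EQUILIBRIUM RUNGS of the energy channel: [TSχ] (two-scale regularity of the energy value) and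
# [KqR] (cone-scale collisional energy-flux law) at constant profiles (registered helpers
# `twoScaleValueChi_rung0`, `energyFluxLawCone_rung0`; line `hemisphere-affine-slaving`,
# crux `CollisionalTransferLocality`, stmt-AtomisticToContinuum-9518)

Supporting file (`--supports stmt-AtomisticToContinuum-9518`) landing the two registered helper names of the
skeleton's composition 6 (v20, seat c11) VERBATIM and hypothesis-free. They CERTIFY THE NORMALISATION of the two
research statements of the crux's energy channel: at the homogeneous Gibbs law `G_N = localGibbsLaw σ 1 0 θ N (Φ N)`
(constant profiles `(1, θ, 0)`) both hold, because every term tends to `0` uniformly in `τ ≤ t`: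
* `twoScaleValueChi_rung0` (rung of [TSχ]): the difference of the energy value `Rhs + Kfun` at the zero vector test
  on CONE-kernel block fields `b_r := fun _ y => coneKernel r y 0` (`0 < r < r₀ := 1/4`) and on an admissible
  MESOSCALE kernel family `φ` exceeds `η` on `[0, t]` with `G_N`-probability `≤ δ` for `N ≥ N₀` — from the landed
  [Vχ0C] `stub_valueChi_cone_const` (…ValueChiConeConst, p166460) and [Vχ0M] `stub_valueChi_meso_const`
  (…ValueChiMesoConst, p166653): both values tend to `0` separately; one union bound at level `η/2`
  (`η₁ := 1`; the dilute hypothesis is not used at equilibrium);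
* `energyFluxLawCone_rung0` (rung of [KqR]): the energy mark sum `M_N(0, χ)` minus the cone-scale value exceeds `η`
  with probability `≤ δ` eventually — two triangle steps `M − V_r = (M − V_N) + (V_N − 0) − (V_r − 0)`: the crux's
  unconditional equilibrium rung `equilibriumRungFlow_unconditional` (…EquilibriumRungAssembly, p168756) through
  c9's `markedVirialE_rung0_of_equilibriumRung` (…FmrRung0: `sup_τ |M_N − (Rhs + Kfun)[φ_N]| → 0` in probability for
  all smooth tests, here `(0, χ)`), then [Vχ0M] and [Vχ0C] (the `VirialBounded` and dilute hypotheses are not used).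
Plumbing (namespace `EnergyRung0`): `exists_N0_of_tendsto_cover` (two vanishing sequences of events covering a
third give `∃ N₀, ∀ N ≥ N₀, ≤ ofReal δ`) and `half_lt_abs_or_of_lt_abs_sub` (level splitting `η < |a − b| →
η/2 < |a − c| ∨ η/2 < |c − b|`). Folklore; no definitions, no named facts.
-/

namespace Summit.AtomisticToContinuum.HydrodynamicLimit.Theorems.HemisphereAffineSlaving

open scoped BigOperators Topology Classical ENNReal InnerProductSpace
open Filter Set Function MeasureTheory

noncomputable section

open Literature.MathematicalPhysics.KineticTheory (T3 V3)
open Literature.Analysis.FunctionSpaces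

namespace EnergyRung0

/-- Measure plumbing: two `Tendsto … (𝓝 0)` sequences of events covering a third at level-splitting give an
`∃ N₀, ∀ N ≥ N₀, ≤ ofReal δ` bound. [folklore] -/
theorem exists_N0_of_tendsto_cover {α : ℕ → Type*} [∀ N, MeasurableSpace (α N)] (P : (N : ℕ) → Measure (α N))
    (A B E : (N : ℕ) → Set (α N)) (hA : Tendsto (fun N => P N (A N)) atTop (𝓝 0))
    (hB : Tendsto (fun N => P N (B N)) atTop (𝓝 0))
    (hcov : ∀ N, E N ⊆ A N ∪ B N) {δ : ℝ} (hδ : 0 < δ) :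
    ∃ N₀ : ℕ, ∀ N : ℕ, N₀ ≤ N → P N (E N) ≤ ENNReal.ofReal δ := by
  have hsum : Tendsto (fun N => P N (A N) + P N (B N)) atTop (𝓝 0) := by simpa using hA.add hB
  have hev : ∀ᶠ N in atTop, P N (A N) + P N (B N) ≤ ENNReal.ofReal δ :=
    (hsum.eventually (ge_mem_nhds (ENNReal.ofReal_pos.2 hδ)))
  obtain ⟨N₀, hN₀⟩ := eventually_atTop.1 hev
  exact ⟨N₀, fun N hN => ((measure_mono (hcov N)).trans (measure_union_le _ _)).trans (hN₀ N hN)⟩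

/-- The level-splitting inclusion behind every triangle step of this file: if `η < |a - b|` then `η/2 < |a - c|`
or `η/2 < |c - b|`. [folklore] -/
theorem half_lt_abs_or_of_lt_abs_sub {η a b : ℝ} (c : ℝ) (h : η < |a - b|) :
    η / 2 < |a - c| ∨ η / 2 < |c - b| := by
  by_contra hcon
  push Not at hcon
  have := abs_sub_le a c b
  linarith

end EnergyRung0

/-- **The equilibrium rung of [TSχ]** (composition 6a of the skeleton) from the landed [Vχ0C]
`stub_valueChi_cone_const` and [Vχ0M] `stub_valueChi_meso_const` (`η₁ := 1`, `r₀ := 1/4`; the dilute hypothesis is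
not even used at equilibrium: both energy values tend to `0` separately, union bound at level `η/2`). [folklore] -/
theorem twoScaleValueChi_rung0 : ∀ θ : ℝ, 0 < θ → ∃ σ₀ : ℝ, 0 < σ₀ ∧ ∃ η₁ : ℝ, 0 < η₁ ∧ ∀ σ : ℝ, 0 < σ → σ < σ₀ → ∀ (Φ : Flows σ) (t : ℝ), 0 < t → ∀ (γ C : ℝ) (φ : ℕ → T3 → ℝ), 0 < γ → γ ≤ 1 / 15 → AdmissibleKernel γ C φ → DiluteAt σ (fun _ => 1) (fun _ => θ) (fun _ => 0) Φ t φ η₁ → ∀ (χ : ℝ → T3 → ℝ), Literature.Analysis.FunctionSpaces.Torus.IsSmoothSpaceTimeOn (Icc 0 t) χ → ∀ η δ : ℝ, 0 < η → 0 < δ → ∃ r₀ : ℝ, 0 < r₀ ∧ ∀ r : ℝ, 0 < r → r < r₀ → ∃ N₀ : ℕ, ∀ N : ℕ, N₀ ≤ N → Literature.MathematicalPhysics.KineticTheory.localGibbsLaw σ (fun _ => 1) (fun _ => 0) (fun _ => θ) N (Φ N) {z | ∃ τ ∈ Icc 0 t, η < |(Rhs σ Φ (fun (_ : ℕ) (y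 : T3) => Literature.MathematicalPhysics.KineticTheory.coneKernel r y 0) (fun (_ : ℝ) (_ : T3) => (0 : V3)) χ N z τ + Kfun σ Φ (fun (_ : ℕ) (y : T3) => Literature.MathematicalPhysics.KineticTheory.coneKernel r y 0) (fun (_ : ℝ) (_ : T3) => (0 : V3)) χ N z τ) - (Rhs σ Φ φ (fun (_ : ℝ) (_ : T3) => (0 : V3)) χ N z τ + Kfun σ Φ φ (fun (_ : ℝ) (_ : T3) => (0 : V3)) χ N z τ)|} ≤ ENNReal.ofReal δ := by
  intro θ hθ
  obtain ⟨σC, hσC, HC⟩ := stub_valueChi_cone_const θ hθ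
  obtain ⟨σM, hσM, HM⟩ := stub_valueChi_meso_const θ hθ
  refine ⟨min σC σM, lt_min hσC hσM, 1, one_pos, ?_⟩
  intro σ hσ hlt Φ t ht γ C φ hγ hγ' hadm _hD χ hχ η δ hη hδ
  have hltC : σ < σC := lt_of_lt_of_le hlt (min_le_left _ _)
  have hltM : σ < σM := lt_of_lt_of_le hlt (min_le_right _ _)
  refine ⟨1 / 4, by norm_num, fun r hr hr4 => ?_⟩
  have hA := HC σ hσ hltC Φ t ht r hr hr4 χ hχ (η / 2) (half_pos hη)
  have hB := HM σ hσ hltM Φ t ht γ C φ hγ hγ' hadm χ hχ (η / 2) (half_pos hη)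
  refine EnergyRung0.exists_N0_of_tendsto_cover
    (fun N => Literature.MathematicalPhysics.KineticTheory.localGibbsLaw σ (fun _ => 1) (fun _ => 0) (fun _ => θ) N (Φ N))
    _ _ _ hA hB (fun N => ?_) hδ
  rintro z ⟨τ, hτ, hz⟩
  rcases EnergyRung0.half_lt_abs_or_of_lt_abs_sub (0 : ℝ) hz with h | h
  · exact Or.inl ⟨τ, hτ, by simpa using h⟩
  · exact Or.inr ⟨τ, hτ, by rwa [zero_sub, abs_neg] at h⟩

/-- **The equilibrium rung of [KqR]** (composition 6b of the skeleton) from the landed [Vχ0C] `stub_valueChi_cone_const`,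
[Vχ0M] `stub_valueChi_meso_const` and the crux's unconditional equilibrium rung `equilibriumRungFlow_unconditional`,
through c9's `markedVirialE_rung0_of_equilibriumRung` (at constant profiles `sup_τ |M_N − (Rhs + Kfun)[φ_N]| → 0` for ALL
smooth tests, in particular the energy mark sum at `(0, χ)`). Two triangle steps: `M − V_r = (M − V_N) + V_N − V_r`
(`η₁ := 1`, `r₀ := 1/4`; the `VirialBounded` and dilute hypotheses are not used at equilibrium). [folklore] -/
theorem energyFluxLawCone_rung0 : ∀ θ : ℝ, 0 < θ → ∃ σ₀ : ℝ, 0 < σ₀ ∧ ∃ η₁ : ℝ, 0 < η₁ ∧ ∀ σ : ℝ, 0 < σ → σ < σ₀ → ∀ (Φ : Flows σ) (t : ℝ), 0 < t → VirialBounded σ (fun _ => 1) (fun _ => θ) (fun _ => 0) Φ t → ∀ (γ C : ℝ) (φ : ℕ → T3 → ℝ), 0 < γ → γ ≤ 1 / 15 → AdmissibleKernel γ C φ → DiluteAt σ (fun _ => 1) (fun _ => θ) (fun _ => 0) Φ t φ η₁ → ∀ (χ : ℝ → T3 → ℝ), Literature.Analysis.FunctionSpaces.Torus.IsSmoothSpaceTimeOn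 (Icc 0 t) χ → ∀ η δ : ℝ, 0 < η → 0 < δ → ∃ r₀ : ℝ, 0 < r₀ ∧ ∀ r : ℝ, 0 < r → r < r₀ → ∃ N₀ : ℕ, ∀ N : ℕ, N₀ ≤ N → Literature.MathematicalPhysics.KineticTheory.localGibbsLaw σ (fun _ => 1) (fun _ => 0) (fun _ => θ) N (Φ N) {z | ∃ τ ∈ Icc 0 t, η < |Mfun σ Φ (fun (_ : ℝ) (_ : T3) => (0 : V3)) χ N z τ - (Rhs σ Φ (fun (_ : ℕ) (y : T3) => Literature.MathematicalPhysics.KineticTheory.coneKernel r y 0) (fun (_ : ℝ) (_ : T3) => (0 : V3)) χ N z τ + Kfun σ Φ (fun (_ : ℕ) (y : T3) => Literature.MathematicalPhysics.KineticTheory.coneKernel r y 0) (fun (_ : ℝ) (_ : T3) => (0 : V3)) χ N z τ)|} ≤ ENNReal.ofReal δ := by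
  intro θ hθ
  obtain ⟨σC, hσC, HC⟩ := stub_valueChi_cone_const θ hθ
  obtain ⟨σM, hσM, HM⟩ := stub_valueChi_meso_const θ hθ
  obtain ⟨σE, hσE, HE⟩ := markedVirialE_rung0_of_equilibriumRung equilibriumRungFlow_unconditional θ hθ
  refine ⟨min (min σC σM) σE, lt_min (lt_min hσC hσM) hσE, 1, one_pos, ?_⟩
  intro σ hσ hlt Φ t ht _hV γ C φ hγ hγ' hadm _hD χ hχ η δ hη hδ
  have hltC : σ < σC := lt_of_lt_of_le hlt ((min_le_left _ _).trans (min_le_left _ _))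
  have hltM : σ < σM := lt_of_lt_of_le hlt ((min_le_left _ _).trans (min_le_right _ _))
  have hltE : σ < σE := lt_of_lt_of_le hlt (min_le_right _ _)
  refine ⟨1 / 4, by norm_num, fun r hr hr4 => ?_⟩
  have hA := HC σ hσ hltC Φ t ht r hr hr4 χ hχ (η / 2) (half_pos hη)
  have hB0 := HM σ hσ hltM Φ t ht γ C φ hγ hγ' hadm χ hχ (η / 2 / 2) (half_pos (half_pos hη))
  have hE0 := HE σ hσ hltE Φ t ht γ C φ hγ hγ' hadm (fun (_ : ℝ) (_ : T3) => (0 : V3)) χ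
    (Literature.Analysis.FunctionSpaces.Torus.isSmoothSpaceTimeOn_const
      (Literature.Analysis.FunctionSpaces.Torus.isSmooth_const (0 : V3)) _) hχ (η / 2 / 2) (half_pos (half_pos hη))
  -- first cover: `M − V_N` small from the equilibrium [M]° and [Vχ0M]
  have hB : Tendsto (fun N : ℕ => Literature.MathematicalPhysics.KineticTheory.localGibbsLaw σ (fun _ => 1) (fun _ => 0)
      (fun _ => θ) N (Φ N) {z | ∃ τ ∈ Icc 0 t, η / 2 < |Mfun σ Φ (fun (_ : ℝ) (_ : T3) => (0 : V3)) χ N z τ - 0|})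
      atTop (𝓝 0) := by
    have hsum : Tendsto (fun N : ℕ => Literature.MathematicalPhysics.KineticTheory.localGibbsLaw σ (fun _ => 1) (fun _ => 0)
        (fun _ => θ) N (Φ N) {z | ∃ τ ∈ Icc 0 t, η / 2 / 2 < |Mfun σ Φ (fun (_ : ℝ) (_ : T3) => (0 : V3)) χ N z τ -
          (Rhs σ Φ φ (fun (_ : ℝ) (_ : T3) => (0 : V3)) χ N z τ + Kfun σ Φ φ (fun (_ : ℝ) (_ : T3) => (0 : V3)) χ N z τ)|} +
        Literature.MathematicalPhysics.KineticTheory.localGibbsLaw σ (fun _ => 1) (fun _ => 0) (fun _ => θ) N (Φ N)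
          {z | ∃ τ ∈ Icc 0 t, η / 2 / 2 < |(Rhs σ Φ φ (fun (_ : ℝ) (_ : T3) => (0 : V3)) χ N z τ +
            Kfun σ Φ φ (fun (_ : ℝ) (_ : T3) => (0 : V3)) χ N z τ)|}) atTop (𝓝 0) := by
      simpa using hE0.add hB0
    refine tendsto_of_tendsto_of_tendsto_of_le_of_le tendsto_const_nhds hsum (fun N => bot_le) (fun N => ?_)
    refine (measure_mono ?_).trans (measure_union_le _ _)
    rintro z ⟨τ, hτ, hz⟩
    rw [sub_zero] at hz
    rcases EnergyRung0.half_lt_abs_or_of_lt_abs_sub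
        ((Rhs σ Φ φ (fun (_ : ℝ) (_ : T3) => (0 : V3)) χ N z τ + Kfun σ Φ φ (fun (_ : ℝ) (_ : T3) => (0 : V3)) χ N z τ))
        (show η / 2 < |Mfun σ Φ (fun (_ : ℝ) (_ : T3) => (0 : V3)) χ N z τ - 0| by simpa using hz) with h | h
    · exact Or.inl ⟨τ, hτ, h⟩
    · exact Or.inr ⟨τ, hτ, by simpa using h⟩
  refine EnergyRung0.exists_N0_of_tendsto_cover
    (fun N => Literature.MathematicalPhysics.KineticTheory.localGibbsLaw σ (fun _ => 1) (fun _ => 0) (fun _ => θ) N (Φ N))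
    _ _ _ hB hA (fun N => ?_) hδ
  rintro z ⟨τ, hτ, hz⟩
  rcases EnergyRung0.half_lt_abs_or_of_lt_abs_sub (0 : ℝ) hz with h | h
  · exact Or.inl ⟨τ, hτ, h⟩
  · exact Or.inr ⟨τ, hτ, by rwa [zero_sub, abs_neg] at h⟩

end

end Summit.AtomisticToContinuum.HydrodynamicLimit.Theorems.HemisphereAffineSlaving
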